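import Summits.SmoothPoincare4.SmoothPoincare4.Theorems.ContractibleTwistedDoubleStandard.Negative.DoubleBisection
import Literature.Geometry.Symplectic.BoundaryContactomorphism
import Mathlib.Geometry.Manifold.Diffeomorph

/-!
# Stub `stub_seam` of line `legendrian-r-knot-rigidity` for crux `ConvexBisection.ContractibleTwistedDoubleStandard`
(item stmt-SmoothPoincare4-3546, route route-SmoothPoincare4-ConvexBisection)

The **seam map** of a Stein bisection.  Let `e₁ : W₁ → X`, `e₂ : W₂ → X` be smooth embeddings of
two compact Stein domains (model `𝓡∂ 4`) into a `4`-manifold `X` whose images meet exactly along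
the images of BOTH boundaries,
`range e₁ ∩ range e₂ = e₁ '' ∂W₁ = e₂ '' ∂W₂`, and whose pushed-forward complex tangencies
`deᵢ (ξ_{Jᵢ})`, `ξ_{Jᵢ} = contactPlane Jᵢ.J`, agree at common points.  For any abstract boundary
data `b₁ : BoundaryData (𝓡∂ 4) W₁ (𝓡 3)`, `b₂ : BoundaryData (𝓡∂ 4) W₂ (𝓡 3)` (boundaryless
`3`-manifolds `bᵢ.carrier` smoothly embedded onto `∂Wᵢ` by `bᵢ.incl`), the seam map
`ψ = incl₂⁻¹ ∘ e₂⁻¹ ∘ e₁ ∘ incl₁ : b₁.carrier → b₂.carrier` is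

* a well-defined bijection (both `e₁ ∘ incl₁` and `e₂ ∘ incl₂` are injective with the same image,
  the seam `range e₁ ∩ range e₂`);
* continuous in both directions (`e₂ ∘ incl₂` is a topological embedding, so continuity of `ψ` is
  continuity of `e₂ ∘ incl₂ ∘ ψ = e₁ ∘ incl₁`; Mathlib `Topology.IsEmbedding.continuous_iff`);
* smooth in both directions: a continuous map `f` into the source of an immersion `φ` is `C^∞` iff
  `φ ∘ f` is (Mathlib `ContMDiff.iff_comp_isImmersion`, the slice-chart argument of
  Lee, *Introduction to Smooth Manifolds* (2013), Thm. 5.29), applied through the two immersions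
  `incl₂` and `e₂` — this is the uniqueness of the smooth structure of the embedded submanifold
  `e₁(∂W₁) = e₂(∂W₂) ⊂ X` (Lee 2013, Thm. 5.31);
* a contactomorphism `(∂W₁, ξ_{J₁}) → (∂W₂, ξ_{J₂})` in the sense of
  `Literature.Geometry.Symplectic.IsContacto` (Geiges, *An Introduction to Contact Topology* (2008),
  §2.1): by the chain rule `de₂ (d(incl₂ ∘ ψ) v) = de₁ (d incl₁ v)`, the matching of the
  pushed-forward planes and injectivity of the differentials of the immersions `e₁`, `e₂`
  (`Literature.Topology.FourManifolds.Manifold.IsImmersionAt.mfderiv_injective`).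

Neither the cover `range e₁ ∪ range e₂ = univ` nor contractibility of the halves is used.
This is the registered stub `stub_seam` of the checked skeleton of the line; all of it is standard
differential topology. [folklore]
-/

noncomputable section

-- the prescribed namespace `Summit.<P>.<Sub>.…` duplicates `SmoothPoincare4` (P = Sub)
set_option linter.dupNamespace false

open scoped Manifold ContDiff Topology
open Set Function Literature.Geometry.Symplectic Literature.Topology.FourManifolds

namespace Summit.SmoothPoincare4.SmoothPoincare4.Theorems.ContractibleTwistedDoubleStandard.LegendrianRKnotRigidity

section Helpers

variable {X : Type*} {W : Type*} [TopologicalSpace W] [ChartedSpace (EuclideanHalfSpace 4) W]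

/-- **Smoothness of a map read through two immersions.**  If `e : W → X` is a smooth embedding,
`b` a boundary datum of `W`, and `ψ : N → b.carrier` is any map such that `e ∘ b.incl ∘ ψ = f` is
`C^∞`, then `ψ` is `C^∞`: `e ∘ b.incl` is a topological embedding, so `ψ` is continuous, and a
continuous map into the source of an immersion is smooth iff its composite with the immersion is
(Mathlib `ContMDiff.iff_comp_isImmersion`, twice).  Lee, *Introduction to Smooth Manifolds* (2013),
Thm. 5.29 / Cor. 5.30. [folklore] -/
private theorem contMDiff_of_comp_incl_eq [TopologicalSpace X]
    [ChartedSpace (EuclideanSpace ℝ (Fin 4)) X] {N : Type*} [TopologicalSpace N]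
    [ChartedSpace (EuclideanSpace ℝ (Fin 3)) N] {e : W → X}
    (he : Manifold.IsSmoothEmbedding (𝓡∂ 4) (𝓡 4) ∞ e) (b : BoundaryData (𝓡∂ 4) W (𝓡 3))
    {ψ : N → b.carrier} {f : N → X} (hf : ContMDiff (𝓡 3) (𝓡 4) ∞ f)
    (h : ∀ z, e (b.incl (ψ z)) = f z) : ContMDiff (𝓡 3) (𝓡 3) ∞ ψ := by
  have hcomp : (e ∘ b.incl) ∘ ψ = f := funext h
  have hcomp' : e ∘ (b.incl ∘ ψ) = f := funext h
  have hemb : Topology.IsEmbedding (e ∘ b.incl) :=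
    he.isEmbedding.comp b.isSmoothEmbedding.isEmbedding
  have hcont : Continuous ψ := by
    rw [hemb.continuous_iff, hcomp]
    exact hf.continuous
  rw [ContMDiff.iff_comp_isImmersion b.isSmoothEmbedding.isImmersion]
  refine ⟨hcont, ?_⟩
  rw [ContMDiff.iff_comp_isImmersion he.isImmersion, hcomp']
  exact ⟨b.continuous_incl.comp hcont, hf⟩

/-- **Seam points come from the abstract boundary of the other half.**  If the images of
`e : W → X` and `e' : W' → X` meet exactly in `e '' ∂W` and exactly in `e' '' ∂W'`, then for
boundary data `b`, `b'` every point `e (b.incl z)` is of the form `e' (b'.incl w)`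
(`b'.range_incl : range b'.incl = ∂W'`). [folklore] -/
private theorem exists_incl_eq_of_seam {W' : Type*} [TopologicalSpace W']
    [ChartedSpace (EuclideanHalfSpace 4) W'] {e : W → X} {e' : W' → X}
    (hI : range e ∩ range e' = e '' (𝓡∂ 4).boundary W)
    (hI' : range e ∩ range e' = e' '' (𝓡∂ 4).boundary W')
    (b : BoundaryData (𝓡∂ 4) W (𝓡 3)) (b' : BoundaryData (𝓡∂ 4) W' (𝓡 3)) (z : b.carrier) :
    ∃ w : b'.carrier, e' (b'.incl w) = e (b.incl z) := by
  have hmem : e (b.incl z) ∈ range e ∩ range e' := by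
    rw [hI]
    exact ⟨b.incl z, b.incl_mem_boundary z, rfl⟩
  rw [hI'] at hmem
  obtain ⟨w', hw', hw'e⟩ := hmem
  rw [← b'.range_incl] at hw'
  obtain ⟨w, rfl⟩ := hw'
  exact ⟨w, hw'e⟩

end Helpers

section Contacto

variable {X : Type*} [TopologicalSpace X] [ChartedSpace (EuclideanSpace ℝ (Fin 4)) X]
  [IsManifold (𝓡 4) ∞ X]
  {W₁ : Type*} [TopologicalSpace W₁] [ChartedSpace (EuclideanHalfSpace 4) W₁]
  [IsManifold (𝓡∂ 4) ∞ W₁] [CompactSpace W₁]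
  {W₂ : Type*} [TopologicalSpace W₂] [ChartedSpace (EuclideanHalfSpace 4) W₂]
  [IsManifold (𝓡∂ 4) ∞ W₂] [CompactSpace W₂]

/-- **The seam map is a contactomorphism.**  If `e₂ ∘ incl₂ ∘ ψ = e₁ ∘ incl₁` with `ψ` smooth and
the pushed-forward complex tangencies agree at common points, then `ψ` carries `d(incl₁)⁻¹ ξ₁` onto
`d(incl₂)⁻¹ ξ₂`: chain rule `de₂ (d(incl₂ ∘ ψ) v) = de₁ (d incl₁ v)`, the matching
`de₁ ξ₁ = de₂ ξ₂` at `(incl₁ z, incl₂ (ψ z))`, and injectivity of `de₁`, `de₂` (immersions).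
Geiges, *An Introduction to Contact Topology* (2008), §2.1. [folklore] -/
private theorem isContacto_of_seam (J₁ : SteinStructure W₁) (J₂ : SteinStructure W₂)
    {e₁ : W₁ → X} {e₂ : W₂ → X}
    (h₁ : Manifold.IsSmoothEmbedding (𝓡∂ 4) (𝓡 4) ∞ e₁)
    (h₂ : Manifold.IsSmoothEmbedding (𝓡∂ 4) (𝓡 4) ∞ e₂)
    (hC : ∀ w₁ w₂, e₁ w₁ = e₂ w₂ →
      Submodule.map (mfderiv (𝓡∂ 4) (𝓡 4) e₁ w₁).toLinearMap (contactPlane J₁.J w₁) =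
        Submodule.map (mfderiv (𝓡∂ 4) (𝓡 4) e₂ w₂).toLinearMap (contactPlane J₂.J w₂))
    (b₁ : BoundaryData (𝓡∂ 4) W₁ (𝓡 3)) (b₂ : BoundaryData (𝓡∂ 4) W₂ (𝓡 3))
    {ψ : b₁.carrier → b₂.carrier} (hψs : ContMDiff (𝓡 3) (𝓡 3) ∞ ψ)
    (hψ : ∀ z, e₂ (b₂.incl (ψ z)) = e₁ (b₁.incl z)) : IsContacto J₁ J₂ b₁ b₂ ψ := by
  intro z v
  -- differentiability of the players
  have hi₁ : MDifferentiableAt (𝓡 3) (𝓡∂ 4) b₁.incl z :=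
    b₁.isSmoothEmbedding.contMDiff.mdifferentiableAt (by simp)
  have hi₂ψ : MDifferentiableAt (𝓡 3) (𝓡∂ 4) (b₂.incl ∘ ψ) z :=
    (b₂.isSmoothEmbedding.contMDiff.comp hψs).mdifferentiableAt (by simp)
  have he₁ : MDifferentiableAt (𝓡∂ 4) (𝓡 4) e₁ (b₁.incl z) :=
    h₁.contMDiff.mdifferentiableAt (by simp)
  have he₂ : MDifferentiableAt (𝓡∂ 4) (𝓡 4) e₂ ((b₂.incl ∘ ψ) z) :=
    h₂.contMDiff.mdifferentiableAt (by simp)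
  -- the chain rule on `e₂ ∘ (incl₂ ∘ ψ) = e₁ ∘ incl₁`
  have hcomp : e₂ ∘ (b₂.incl ∘ ψ) = e₁ ∘ b₁.incl := funext hψ
  have key : mfderiv (𝓡∂ 4) (𝓡 4) e₂ (b₂.incl (ψ z)) (mfderiv (𝓡 3) (𝓡∂ 4) (b₂.incl ∘ ψ) z v) =
      mfderiv (𝓡∂ 4) (𝓡 4) e₁ (b₁.incl z) (mfderiv (𝓡 3) (𝓡∂ 4) b₁.incl z v) := by
    rw [← mfderiv_comp_apply z he₁ hi₁ v, ← hcomp]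
    exact (mfderiv_comp_apply z he₂ hi₂ψ v).symm
  -- the matching of the pushed-forward planes at the seam point
  have hM := hC (b₁.incl z) (b₂.incl (ψ z)) (hψ z).symm
  -- read everything on the model spaces `ℝ⁴ = T W = T X ⊇ T∂W` (Mathlib's `TangentSpace` is the
  -- model vector space), pinning the types down
  set D₁ : EuclideanSpace ℝ (Fin 4) →L[ℝ] EuclideanSpace ℝ (Fin 4) :=
    mfderiv (𝓡∂ 4) (𝓡 4) e₁ (b₁.incl z)
  set D₂ : EuclideanSpace ℝ (Fin 4) →L[ℝ] EuclideanSpace ℝ (Fin 4) :=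
    mfderiv (𝓡∂ 4) (𝓡 4) e₂ (b₂.incl (ψ z))
  set a : EuclideanSpace ℝ (Fin 4) := mfderiv (𝓡 3) (𝓡∂ 4) b₁.incl z v
  set c : EuclideanSpace ℝ (Fin 4) := mfderiv (𝓡 3) (𝓡∂ 4) (b₂.incl ∘ ψ) z v
  have key' : D₂ c = D₁ a := key
  have hM' : Submodule.map (D₁ : EuclideanSpace ℝ (Fin 4) →ₗ[ℝ] EuclideanSpace ℝ (Fin 4))
        (contactPlane J₁.J (b₁.incl z)) =
      Submodule.map (D₂ : EuclideanSpace ℝ (Fin 4) →ₗ[ℝ] EuclideanSpace ℝ (Fin 4))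
        (contactPlane J₂.J (b₂.incl (ψ z))) := hM
  -- injectivity of the differentials of the two immersions
  have hinj₁ : Injective D₁ :=
    Manifold.IsImmersionAt.mfderiv_injective (h₁.isImmersion.isImmersionAt _) (by simp)
  have hinj₂ : Injective D₂ :=
    Manifold.IsImmersionAt.mfderiv_injective (h₂.isImmersion.isImmersionAt _) (by simp)
  constructor
  · intro hv
    have hmem : D₂ c ∈ Submodule.map (D₁ : EuclideanSpace ℝ (Fin 4) →ₗ[ℝ] EuclideanSpace ℝ (Fin 4))
        (contactPlane J₁.J (b₁.incl z)) := by
      rw [hM']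
      exact Submodule.mem_map.2 ⟨c, hv, rfl⟩
    obtain ⟨u, hu, hue⟩ := Submodule.mem_map.1 hmem
    rw [ContinuousLinearMap.coe_coe, key'] at hue
    rw [← hinj₁ hue]
    exact hu
  · intro hv
    have hmem : D₁ a ∈ Submodule.map (D₂ : EuclideanSpace ℝ (Fin 4) →ₗ[ℝ] EuclideanSpace ℝ (Fin 4))
        (contactPlane J₂.J (b₂.incl (ψ z))) := by
      rw [← hM']
      exact Submodule.mem_map.2 ⟨a, hv, rfl⟩
    obtain ⟨u, hu, hue⟩ := Submodule.mem_map.1 hmem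
    rw [ContinuousLinearMap.coe_coe, ← key'] at hue
    rw [← hinj₂ hue]
    exact hu

end Contacto

/-- **Stub `stub_seam` — the seam contactomorphism (folklore).**  For two compact Stein domains
smoothly embedded in a `4`-manifold `X` so that the images meet exactly along the images of BOTH
boundaries, with complex tangencies pushed forward to the same planes at common points, and for any
boundary data `b₁`, `b₂`: the seam map `ψ = incl₂⁻¹ ∘ e₂⁻¹ ∘ e₁ ∘ incl₁` is a diffeomorphism
`b₁.carrier ≅ b₂.carrier` of the abstract boundaries intertwining the embeddings
(`e₂ ∘ incl₂ ∘ ψ = e₁ ∘ incl₁`) and a contactomorphism (`IsContacto`).  Set-theoretically `ψ` is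
forced by injectivity of `e₂ ∘ incl₂`; smoothness of `ψ` and `ψ⁻¹` is the uniqueness of the smooth
structure of the embedded submanifold `e₁(∂W₁) = e₂(∂W₂)` (Lee, *Introduction to Smooth Manifolds*
(2013), Thm. 5.29 and Thm. 5.31, via Mathlib `ContMDiff.iff_comp_isImmersion`); the contact
property is the chain rule plus injectivity of `de₁`, `de₂` (Geiges, *An Introduction to Contact
Topology* (2008), §2.1).  Neither the cover nor contractibility is used. [folklore] -/
theorem stub_seam :
    ∀ (X : Type) [TopologicalSpace X] [T2Space X] [SecondCountableTopology X] [CompactSpace X]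
      [ChartedSpace (EuclideanSpace ℝ (Fin 4)) X] [IsManifold (𝓡 4) ∞ X]
      (W₁ : Type) [TopologicalSpace W₁] [ChartedSpace (EuclideanHalfSpace 4) W₁] [IsManifold (𝓡∂ 4) ∞ W₁]
      [CompactSpace W₁]
      (W₂ : Type) [TopologicalSpace W₂] [ChartedSpace (EuclideanHalfSpace 4) W₂] [IsManifold (𝓡∂ 4) ∞ W₂]
      [CompactSpace W₂]
      (J₁ : SteinStructure W₁) (J₂ : SteinStructure W₂) (e₁ : W₁ → X) (e₂ : W₂ → X),
      Manifold.IsSmoothEmbedding (𝓡∂ 4) (𝓡 4) ∞ e₁ → Manifold.IsSmoothEmbedding (𝓡∂ 4) (𝓡 4) ∞ e₂ →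
      range e₁ ∩ range e₂ = e₁ '' (𝓡∂ 4).boundary W₁ →
      range e₁ ∩ range e₂ = e₂ '' (𝓡∂ 4).boundary W₂ →
      (∀ w₁ w₂, e₁ w₁ = e₂ w₂ →
        Submodule.map (mfderiv (𝓡∂ 4) (𝓡 4) e₁ w₁).toLinearMap (contactPlane J₁.J w₁) =
          Submodule.map (mfderiv (𝓡∂ 4) (𝓡 4) e₂ w₂).toLinearMap (contactPlane J₂.J w₂)) →
      ∀ (b₁ : BoundaryData (𝓡∂ 4) W₁ (𝓡 3)) (b₂ : BoundaryData (𝓡∂ 4) W₂ (𝓡 3)),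
        ∃ ψ : b₁.carrier ≃ₘ⟮𝓡 3, 𝓡 3⟯ b₂.carrier,
          (∀ z, e₂ (b₂.incl (ψ z)) = e₁ (b₁.incl z)) ∧ IsContacto J₁ J₂ b₁ b₂ ψ := by
  intro X _ _ _ _ _ _ W₁ _ _ _ _ W₂ _ _ _ _ J₁ J₂ e₁ e₂ h₁ h₂ hI₁ hI₂ hC b₁ b₂
  -- (1) the seam map and its inverse, set-theoretically
  have hex₁ : ∀ z : b₁.carrier, ∃ w : b₂.carrier, e₂ (b₂.incl w) = e₁ (b₁.incl z) :=
    exists_incl_eq_of_seam hI₁ hI₂ b₁ b₂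
  have hex₂ : ∀ w : b₂.carrier, ∃ z : b₁.carrier, e₁ (b₁.incl z) = e₂ (b₂.incl w) := by
    intro w
    have hI₁' : range e₂ ∩ range e₁ = e₂ '' (𝓡∂ 4).boundary W₂ := by rw [inter_comm]; exact hI₂
    have hI₂' : range e₂ ∩ range e₁ = e₁ '' (𝓡∂ 4).boundary W₁ := by rw [inter_comm]; exact hI₁
    exact exists_incl_eq_of_seam hI₁' hI₂' b₂ b₁ w
  choose ψ hψ using hex₁
  choose φ hφ using hex₂
  have hinj₁ : Injective (e₁ ∘ b₁.incl) := h₁.isEmbedding.injective.comp b₁.injective_incl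
  have hinj₂ : Injective (e₂ ∘ b₂.incl) := h₂.isEmbedding.injective.comp b₂.injective_incl
  have hleft : ∀ z, φ (ψ z) = z := fun z => hinj₁ (by
    show e₁ (b₁.incl (φ (ψ z))) = e₁ (b₁.incl z)
    rw [hφ, hψ])
  have hright : ∀ w, ψ (φ w) = w := fun w => hinj₂ (by
    show e₂ (b₂.incl (ψ (φ w))) = e₂ (b₂.incl w)
    rw [hψ, hφ])
  -- (2)+(3) smoothness of `ψ` and `φ` through the immersions `incl` and `e`
  have hψs : ContMDiff (𝓡 3) (𝓡 3) ∞ ψ :=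
    contMDiff_of_comp_incl_eq h₂ b₂ (h₁.contMDiff.comp b₁.isSmoothEmbedding.contMDiff) hψ
  have hφs : ContMDiff (𝓡 3) (𝓡 3) ∞ φ :=
    contMDiff_of_comp_incl_eq h₁ b₁ (h₂.contMDiff.comp b₂.isSmoothEmbedding.contMDiff) hφ
  let Ψ : b₁.carrier ≃ₘ⟮𝓡 3, 𝓡 3⟯ b₂.carrier :=
    { toFun := ψ
      invFun := φ
      left_inv := hleft
      right_inv := hright
      contMDiff_toFun := hψs
      contMDiff_invFun := hφs }
  -- (4) the contact property
  exact ⟨Ψ, hψ, isContacto_of_seam J₁ J₂ h₁ h₂ hC b₁ b₂ hψs hψ⟩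

end Summit.SmoothPoincare4.SmoothPoincare4.Theorems.ContractibleTwistedDoubleStandard.LegendrianRKnotRigidity

end
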